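import Summits.ResolutionOfSingularities.ResolutionOfSingularities.Theorems.FrobeniusClosingSteerNotCoarseningArchSeq
import Summits.ResolutionOfSingularities.ResolutionOfSingularities.Theorems.FrobeniusClosingSteerQuadraticStepLemmas
import Mathlib.Algebra.Order.GroupWithZero.Basic
import HarnessLib

/-!
# Crux `Steer` (stmt-ResolutionOfSingularities-16345), line `switching_dichotomy`, p = 2 σ-residual: B13b —
# A PERSISTENT EXCEPTIONAL PARAMETER ALONG A POINT TAIL FORCES A DISCRETE VALUATION (rank one, characteristic-free)

OURS (campaign `res-hironaka`, rung L ★L-G4, slot W4.1, chain W4.1; seat `res-L0-w41-stub-4` g3; Theses-free helper for the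
holder res-L0-w41-lead-1's line `switching_dichotomy` (skeleton r22/r23, σ-residual `PointTailConclTwo`, HIGH half) — the
CORE of res-L0-w41-strat-2's stub **B13b `discrete_of_persistentExcParam`** (`L/res-L0-w41-strat-2/R2TwoSigma-s16-strat2.delta.lean`
rev 4 e4924d8597cdaa80, §σ2.16; with B13a it gives B13 «HIGH point tails force discreteness», hence `PointTailConclTwo ∩ HIGH`
holds vacuously on core data); replaces the role of no printed item; NOT a statement of the manuscript under review
[claim: Hironaka2017, status: under-review]; AI-produced, which is weaker than expert review).

**`discrete_of_persistentExcParam_core`.** Let `R i₀ ⊆ R (i₀+1) ⊆ ⋯` be quadratic transforms along a valuation ring `O ≠ K`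
of rank one (no proper coarsening), `R i₀` dominated by `O`, and let ONE element `x` be an exceptional parameter of EVERY
member `R i`, `i ≥ i₀` (non-zero, of positive and maximal value in the centre). Then every non-zero element of `R i₀` has value
a natural power of `v x` (divide by `x` while in the maximal ideal — `𝔪_i ⊆ x · R (i+1)` — and stop by the archimedean
property), so if moreover every `z ∈ Kˣ` satisfies `z ^ p · b = a` with `a, b ∈ R i₀` non-zero (`p > 0`; e.g. `[K : Frac R i₀] = p`
purely inseparable), then `(v z) ^ p ∈ (v x) ^ ℤ` for all `z ∈ Kˣ`, the exponents form a subgroup `d ℤ` of `ℤ` with `d > 0`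
attained by some `π`, and `v z = (v π) ^ n`: `O` is DISCRETE in the sense of the skeleton (`Discrete O`, unfolded:
`∃ π ≠ 0, v π < 1 ∧ ∀ z ≠ 0, ∃ n : ℤ, v z = v π ^ n`). The literal B13b leaf (binders `IsSteeredRun` / `IsPointStep` /
`IsExcParamAlong`) is the holder's short adapter: at a point step `P i = 𝔪 (R i)`, `IsLocalBlowupAlong O (R i) (P i) (R (i+1))`
is `IsQuadraticTransformAlong O (R i) (R (i+1))` by definition and `IsExcParamAlong O (R i) (P i) x` is the exceptional-parameter
shape used here (membership in `𝔪` ↔ value `< 1` by domination). [folklore]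
-/

-- `Summit.<S>.<S>.…` duplicates the summit name by design (single-problem summit).
set_option linter.dupNamespace false

open IsLocalRing
open Literature.AlgebraicGeometry.Resolution

namespace Summit.ResolutionOfSingularities.ResolutionOfSingularities.Theorems.SwitchingDichotomy

namespace EventualMonomial

open Summit.ResolutionOfSingularities.ResolutionOfSingularities.Theorems.SteerRankThinness
  (HasProperCoarsening rankOne_of_not_hasProperCoarsening)

variable {K : Type} [Field K]

/-- **Values along a persistent exceptional parameter are natural powers.** If `x` is an exceptional parameter of every
member `R i`, `i ≥ i₀`, of a sequence of quadratic transforms along the rank-one `O` (with `R i₀` dominated by `O`), then every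
non-zero `z ∈ R i₀` has `v z = v x ^ a` for some `a : ℕ`. [folklore] -/
theorem valuation_eq_pow_of_persistentExcParam (O : ValuationSubring K) (hr : Nonempty O.valuation.RankOne)
    (R : ℕ → Subring K) (i₀ : ℕ) (x : K)
    (hstep : ∀ i, i₀ ≤ i → IsQuadraticTransformAlong O (R i) (R (i + 1)))
    (hdom : SubringDominates (R i₀) O.toSubring)
    (hx : ∀ i, i₀ ≤ i → x ∈ R i ∧ x ≠ 0 ∧ O.valuation x < 1 ∧
      ∀ y ∈ R i, O.valuation y < 1 → O.valuation y ≤ O.valuation x)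
    (z : K) (hz : z ∈ R i₀) (hz0 : z ≠ 0) :
    ∃ a : ℕ, O.valuation z = O.valuation x ^ a := by
  classical
  have hx0 : x ≠ 0 := (hx i₀ le_rfl).2.1
  have hvx : O.valuation x < 1 := (hx i₀ le_rfl).2.2.1
  have hvx0 : O.valuation x ≠ 0 := (map_ne_zero _).mpr hx0
  -- domination at every later stage
  have hRdom : ∀ i, i₀ ≤ i → SubringDominates (R i) O.toSubring := by
    intro i hi
    induction i, hi using Nat.le_induction with
    | base => exact hdom
    | succ i hi _ => exact (hstep i hi).dominated
  -- while the quotients stay in the maximal ideal, keep dividing by `x`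
  have hmem : ∀ j, (∀ i, i < j → O.valuation (z / x ^ i) < 1) → z / x ^ j ∈ R (i₀ + j) := by
    intro j
    induction j with
    | zero => intro _; simpa using hz
    | succ j ih =>
      intro hlt
      have hj : z / x ^ j ∈ R (i₀ + j) := ih fun i hi => hlt i (Nat.lt_succ_of_lt hi)
      have hvj : O.valuation (z / x ^ j) < 1 := hlt j (Nat.lt_succ_self j)
      have h := QuadraticStep.div_mem_of_isQuadraticTransformAlong (hstep (i₀ + j) (Nat.le_add_right _ _))
        (hRdom (i₀ + j) (Nat.le_add_right _ _)) (hx (i₀ + j) (Nat.le_add_right _ _)).1 hx0 hvx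
        (hx (i₀ + j) (Nat.le_add_right _ _)).2.2.2 hj hvj
      rw [pow_succ, ← div_div]
      exact h
  -- archimedean: some quotient has value `≥ 1`; take the first
  obtain ⟨n, hn⟩ := exists_pow_valuation_lt_of_rankOne O hr hvx hz0
  have hex : ∃ j, 1 ≤ O.valuation (z / x ^ j) := by
    refine ⟨n, ?_⟩
    rw [map_div₀, map_pow, le_div_iff₀ (pow_pos ((Valuation.pos_iff _).mpr hx0) n), one_mul]
    exact hn.le
  let j₀ := Nat.find hex
  have hj₀ : 1 ≤ O.valuation (z / x ^ j₀) := Nat.find_spec hex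
  have hlt : ∀ i, i < j₀ → O.valuation (z / x ^ i) < 1 := fun i hi =>
    not_le.mp (Nat.find_min hex hi)
  have hmemj : z / x ^ j₀ ∈ R (i₀ + j₀) := hmem j₀ hlt
  have hle : O.valuation (z / x ^ j₀) ≤ 1 :=
    (O.valuation_le_one_iff _).mpr ((hRdom _ (Nat.le_add_right _ _)).1 hmemj)
  refine ⟨j₀, ?_⟩
  have h1 : O.valuation (z / x ^ j₀) = 1 := le_antisymm hle hj₀
  rw [map_div₀, map_pow, div_eq_one_iff_eq (pow_ne_zero _ hvx0)] at h1
  exact h1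

/-- **B13b, core form · a persistent exceptional parameter forces a discrete valuation.** Along quadratic transforms
`R i₀ ⊆ R (i₀+1) ⊆ ⋯` along a valuation ring `O ≠ K` WITHOUT proper coarsening (rank one), `R i₀` dominated by `O`: if one
element `x` is an exceptional parameter of every member `R i` (`i ≥ i₀`) and every `z ∈ Kˣ` satisfies `z ^ p · b = a` with
`a, b ∈ R i₀` non-zero (`p > 0`), then `O` is DISCRETE: `∃ π ≠ 0, v π < 1 ∧ ∀ z ≠ 0, ∃ n : ℤ, v z = v π ^ n` (the skeleton's
`Discrete O`, unfolded). [folklore] -/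
theorem discrete_of_persistentExcParam_core (O : ValuationSubring K) (hO : O ≠ ⊤)
    (hnc : ¬ HasProperCoarsening O) (R : ℕ → Subring K) (p : ℕ) (hp : 0 < p) (i₀ : ℕ) (x : K)
    (hstep : ∀ i, i₀ ≤ i → IsQuadraticTransformAlong O (R i) (R (i + 1)))
    (hdom : SubringDominates (R i₀) O.toSubring)
    (hx : ∀ i, i₀ ≤ i → x ∈ R i ∧ x ≠ 0 ∧ O.valuation x < 1 ∧
      ∀ y ∈ R i, O.valuation y < 1 → O.valuation y ≤ O.valuation x)
    (hK : ∀ z : K, z ≠ 0 → ∃ a b : R i₀, (a : K) ≠ 0 ∧ (b : K) ≠ 0 ∧ z ^ p * (b : K) = a) :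
    ∃ π : K, π ≠ 0 ∧ O.valuation π < 1 ∧ ∀ z : K, z ≠ 0 → ∃ n : ℤ, O.valuation z = O.valuation π ^ n := by
  classical
  have hr := rankOne_of_not_hasProperCoarsening O hO hnc
  have hx0 : x ≠ 0 := (hx i₀ le_rfl).2.1
  have hvx : O.valuation x < 1 := (hx i₀ le_rfl).2.2.1
  have hvx0 : 0 < O.valuation x := (Valuation.pos_iff _).mpr hx0
  have hvx1 : O.valuation x ≠ 1 := hvx.ne
  -- every `z ∈ Kˣ` has `(v z) ^ p = (v x) ^ m` for a (unique) integer `m`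
  have hexp : ∀ z : K, z ≠ 0 → ∃ m : ℤ, O.valuation z ^ p = O.valuation x ^ m := by
    intro z hz
    obtain ⟨a, b, ha0, hb0, hab⟩ := hK z hz
    obtain ⟨α, hα⟩ := valuation_eq_pow_of_persistentExcParam O hr R i₀ x hstep hdom hx a a.2 ha0
    obtain ⟨β, hβ⟩ := valuation_eq_pow_of_persistentExcParam O hr R i₀ x hstep hdom hx b b.2 hb0
    refine ⟨(α : ℤ) - (β : ℤ), ?_⟩
    have hvb : O.valuation (b : K) ≠ 0 := (map_ne_zero _).mpr hb0
    have h : O.valuation z ^ p * O.valuation (b : K) = O.valuation (a : K) := by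
      rw [← map_pow, ← map_mul, hab]
    rw [zpow_sub₀ hvx0.ne', zpow_natCast, zpow_natCast, ← hα, ← hβ, eq_div_iff hvb]
    exact h
  -- the least positive exponent `d`, attained by `π`
  have hpos : ∃ d : ℕ, 0 < d ∧ ∃ z : K, z ≠ 0 ∧ O.valuation z ^ p = O.valuation x ^ (d : ℤ) :=
    ⟨p, hp, x, hx0, by rw [zpow_natCast]⟩
  let d := Nat.find hpos
  obtain ⟨hd, π, hπ0, hπ⟩ : 0 < d ∧ ∃ z : K, z ≠ 0 ∧ O.valuation z ^ p = O.valuation x ^ (d : ℤ) :=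
    Nat.find_spec hpos
  have hdmin : ∀ r : ℕ, 0 < r → r < d → ∀ z : K, z ≠ 0 → O.valuation z ^ p ≠ O.valuation x ^ (r : ℤ) :=
    fun r hr0 hrd z hz h => Nat.find_min hpos hrd ⟨hr0, z, hz, h⟩
  have hvπ0 : 0 < O.valuation π := (Valuation.pos_iff _).mpr hπ0
  -- `v π < 1`
  have hvπ : O.valuation π < 1 := by
    by_contra hcon
    have h1 : 1 ≤ O.valuation π ^ p := one_le_pow₀ (not_lt.mp hcon)
    have h2 : O.valuation x ^ (d : ℤ) < 1 := by
      rw [zpow_natCast]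
      exact pow_lt_one₀ hvx0.le hvx hd.ne'
    rw [← hπ] at h2
    exact not_lt.mpr h1 h2
  refine ⟨π, hπ0, hvπ, fun z hz => ?_⟩
  obtain ⟨m, hm⟩ := hexp z hz
  -- Euclid: `m = (m / d) * d + m % d`; the remainder exponent is attained by `z * π ^ (-(m / d))`, so it is `0`
  have hd0 : (d : ℤ) ≠ 0 := by exact_mod_cast hd.ne'
  have hmqr : m = m / (d : ℤ) * (d : ℤ) + m % (d : ℤ) := by
    linear_combination (-1 : ℤ) * Int.emod_add_ediv_mul m (d : ℤ)
  have hr0 : 0 ≤ m % (d : ℤ) := Int.emod_nonneg m hd0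
  have hrd : m % (d : ℤ) < (d : ℤ) := Int.emod_lt_of_pos m (by exact_mod_cast hd)
  obtain ⟨r, hr⟩ : ∃ r : ℕ, (r : ℤ) = m % (d : ℤ) := ⟨(m % (d : ℤ)).toNat, Int.toNat_of_nonneg hr0⟩
  have hw : O.valuation (z * π ^ (-(m / (d : ℤ)))) ^ p = O.valuation x ^ (r : ℤ) := by
    calc O.valuation (z * π ^ (-(m / (d : ℤ)))) ^ p
        = O.valuation z ^ p * (O.valuation π ^ (-(m / (d : ℤ)))) ^ p := by
          rw [map_mul, map_zpow₀, mul_pow]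
      _ = O.valuation x ^ m * (O.valuation π ^ p) ^ (-(m / (d : ℤ))) := by
          rw [hm, ← zpow_natCast (O.valuation π ^ (-(m / (d : ℤ)))) p, ← zpow_mul,
            mul_comm (-(m / (d : ℤ))) (p : ℤ), zpow_mul, zpow_natCast]
      _ = O.valuation x ^ m * (O.valuation x ^ (d : ℤ)) ^ (-(m / (d : ℤ))) := by rw [hπ]
      _ = O.valuation x ^ (m + (d : ℤ) * (-(m / (d : ℤ)))) := by
          rw [← zpow_mul, ← zpow_add₀ hvx0.ne']
      _ = O.valuation x ^ (r : ℤ) := by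
          congr 1
          rw [hr]
          linear_combination hmqr
  have hr_zero : r = 0 := by
    by_contra hrne
    have hrpos : 0 < r := Nat.pos_of_ne_zero hrne
    have hrd' : r < d := by exact_mod_cast (hr ▸ hrd : (r : ℤ) < (d : ℤ))
    have hzπ : z * π ^ (-(m / (d : ℤ))) ≠ 0 := mul_ne_zero hz (zpow_ne_zero _ hπ0)
    exact hdmin r hrpos hrd' _ hzπ hw
  have hm' : m = (d : ℤ) * (m / (d : ℤ)) := by
    have h0 : m % (d : ℤ) = 0 := by rw [← hr, hr_zero, Nat.cast_zero]
    linear_combination hmqr + h0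
  refine ⟨m / (d : ℤ), ?_⟩
  -- `(v z) ^ p = (v x) ^ (d q) = ((v π) ^ q) ^ p`, and `p`-th powers are injective on the value group
  have hzp : O.valuation z ^ p = (O.valuation π ^ (m / (d : ℤ))) ^ p := by
    calc O.valuation z ^ p = O.valuation x ^ ((d : ℤ) * (m / (d : ℤ))) := by rw [hm, ← hm']
      _ = (O.valuation x ^ (d : ℤ)) ^ (m / (d : ℤ)) := zpow_mul _ _ _
      _ = (O.valuation π ^ p) ^ (m / (d : ℤ)) := by rw [hπ]
      _ = (O.valuation π ^ (m / (d : ℤ))) ^ p := by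
          rw [← zpow_natCast (O.valuation π) p, ← zpow_mul, mul_comm (p : ℤ), zpow_mul, zpow_natCast]
  exact (pow_left_inj₀ zero_le zero_le hp.ne').mp hzp

/-- **B13b, point-tail form (the adapter to res-L0-w41-strat-2's binders).** Along a steered run whose stages `i ≥ i₀` are
POINT steps — so `R (i+1)` is the local blowing up of `R i` along its maximal ideal with respect to `O`
(`IsLocalBlowupAlong`, i.e. a quadratic transform along `O`), every member being `locAtCentre B O` of some `B ⊆ O` — an
element `x` which is an exceptional parameter ALONG THE MAXIMAL IDEAL at every stage `i ≥ i₀` (`IsExcParamAlong O (R i) 𝔪 x`,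
unfolded) forces `Discrete O` (unfolded), given rank one and `z ^ p · b = a` presentations over `R i₀`. From `IsSteeredRun` +
`IsPointStep` the holder obtains `hblow`/`hxm` by rewriting `P i = maximalIdeal (R i)`. [folklore] -/
theorem discrete_of_persistentExcParam_pointTail (O : ValuationSubring K) (hO : O ≠ ⊤)
    (hnc : ¬ HasProperCoarsening O) (R : ℕ → Subring K) (p : ℕ) (hp : 0 < p) (i₀ : ℕ) (x : K)
    (hR : ∀ j, ∃ B : Subring K, B ≤ O.toSubring ∧ R j = locAtCentre B O)
    (hblow : ∀ i, i₀ ≤ i → ∃ _ : IsLocalRing (R i), IsLocalBlowupAlong O (R i) (maximalIdeal (R i)) (R (i + 1)))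
    (hxm : ∀ i, i₀ ≤ i → ∃ (_ : IsLocalRing (R i)), (∃ hx : x ∈ R i, (⟨x, hx⟩ : R i) ∈ maximalIdeal (R i)) ∧ x ≠ 0 ∧
      ∀ y : R i, y ∈ maximalIdeal (R i) → O.valuation (y : K) ≤ O.valuation x)
    (hK : ∀ z : K, z ≠ 0 → ∃ a b : R i₀, (a : K) ≠ 0 ∧ (b : K) ≠ 0 ∧ z ^ p * (b : K) = a) :
    ∃ π : K, π ≠ 0 ∧ O.valuation π < 1 ∧ ∀ z : K, z ≠ 0 → ∃ n : ℤ, O.valuation z = O.valuation π ^ n := by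
  classical
  -- every member is dominated by `O`
  have hdomj : ∀ j, SubringDominates (R j) O.toSubring := fun j => by
    obtain ⟨B, hB, hRj⟩ := hR j
    rw [hRj]
    exact subringDominates_locAtCentre hB
  have hstep : ∀ i, i₀ ≤ i → IsQuadraticTransformAlong O (R i) (R (i + 1)) := fun i hi => by
    obtain ⟨hloc, h⟩ := hblow i hi
    exact ⟨hloc, h⟩
  have hx : ∀ i, i₀ ≤ i → x ∈ R i ∧ x ≠ 0 ∧ O.valuation x < 1 ∧
      ∀ y ∈ R i, O.valuation y < 1 → O.valuation y ≤ O.valuation x := by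
    intro i hi
    obtain ⟨hloc, ⟨hxR, hxm'⟩, hx0, hmaxv⟩ := hxm i hi
    have hmax : ∀ a : R i, a ∈ maximalIdeal (R i) ↔ O.valuation (a : K) < 1 :=
      (subringDominates_valuationSubring_iff (hdomj i).1).mp (hdomj i)
    exact ⟨hxR, hx0, (hmax _).mp hxm', fun y hy hvy => hmaxv ⟨y, hy⟩ ((hmax ⟨y, hy⟩).mpr hvy)⟩
  exact discrete_of_persistentExcParam_core O hO hnc R p hp i₀ x hstep (hdomj i₀) hx hK

end EventualMonomial

end Summit.ResolutionOfSingularities.ResolutionOfSingularities.Theorems.SwitchingDichotomy
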